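import Mathlib.Geometry.Manifold.VectorBundle.Riemannian
import Mathlib.Geometry.Manifold.VectorBundle.Tangent
import Mathlib.Geometry.Manifold.VectorBundle.ContMDiffSection
import Mathlib.Geometry.Manifold.Instances.Real
import Mathlib.Analysis.InnerProductSpace.PiL2
import Literature.Geometry.Lorentzian.PseudoRiemannianMetric
import HarnessLib

-- provenance: harness21/H21/H21/Prelude/Lorentz/LorentzianMetric.lean @ 00c076d (interim HEAD d8f2665); M5 mechanical rewrite
/-!
# Lorentzian metrics, time orientations, spacetimes (trunk G08 = T-LORENTZ, item C2)

This file specialises `Literature.Geometry.Lorentzian.PseudoRiemannianMetric` to the tangent bundle of a real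
manifold `M` modelled on `I : ModelWithCorners ℝ E H` and records the Lorentzian signature
`(−,+,…,+)` in elementary (basis-free) form: there is a timelike vector at every point, and the
`g`-orthogonal complement of any timelike vector is positive definite. This is the first half of
notion `lorentzian_metric_time_orientation` and carries the definition-role statement id
**gr.S13** (Lorentzian manifold + time orientation; the Einstein equations / energy conditions of
gr.S13 live in `Curvature.lean`/`Einstein.lean`).

Contents:
* `PseudoRiemannianMetric.restrict`: restriction of a tangent-bundle metric to `U : Opens M`;
* `LorentzianMetric I n M` (**gr.S13**), `index_eq_one`, `finrank_pos`;
* causal character of tangent vectors: `IsTimelike`, `IsNull`, `IsCausal`, `IsSpacelike`, and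
  the reverse Cauchy–Schwarz inequality;
* `TimeOrientation g` (a `C^n` timelike vector field), `IsFutureDirected`, `IsPastDirected`,
  `reverse`;
* bundled `LorentzianManifold d n` and `Spacetime d` (connected, Hausdorff, second countable,
  time-oriented `C^∞` Lorentzian `d`-manifold, Hawking–Ellis §3.1), and restrictions to open sets.

## Mathlib

Mathlib has Riemannian bundle metrics (`Bundle.ContMDiffRiemannianMetric`) but no
pseudo-Riemannian / Lorentzian metric, no causal character and no time orientation
(`rg -i 'lorentz|timelike|time.?orient' Mathlib/Geometry` is empty). We use Mathlib's `TangentSpace`, `TangentBundle`, `ModelWithCorners.tangent`,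
`TopologicalSpace.Opens` manifold structure (`Opens.instChartedSpace`, `IsManifold I n ↥U`),
`EuclideanSpace ℝ (Fin d)` with `𝓡 d`, and `ContMDiff.neg_section`.

## Design choices

* `TangentSpace I x` is a type synonym of `E`; no global `FiniteDimensional ℝ (TangentSpace I x)`
  instance is registered (finite-dimensionality is only used through `E`).
* Signature is expressed without bases (`exists_timelike`, `pos_of_orthogonal`); the equality
  `index = 1` with O'Neill's index (`sigNeg`) is the named fact `index_eq_one`.
* Following O'Neill, the zero vector is spacelike; null and causal vectors are nonzero by
  definition.
* A time orientation is a `C^n` timelike vector field (equivalent to a continuous choice of time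
  cone on a manifold, O'Neill Ch. 5, Lemma 32).
* Smoothness of restricted sections to `U : Opens M` is recorded in the (true) named facts
  `PseudoRiemannianMetric.contMDiff_restrict`, `TimeOrientation.contMDiff_restrict`, threaded as
  explicit hypotheses `hres`, `hτ` of the `restrict` constructions.
* **Downstream note (M5 migration).** `PseudoRiemannianMetric.restrict`, `LorentzianMetric.restrict`
  now take `hres : PseudoRiemannianMetric.contMDiff_restrict`, `TimeOrientation.restrict` takes
  `hres` and `hτ : τ.contMDiff_restrict`, and `LorentzianManifold.restrict`/`Spacetime.restrict`
  likewise. Importers to adapt (their migrate items are blocked on this file):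
  `Literature.Geometry.Lorentzian.BlackHoles` (`IsIPlusRegular` and the uniqueness statements apply
  `.restrict` inside `Prop` definitions — these statements must take `hres`/`hτ` as parameters),
  `Literature.Geometry.Lorentzian.InitialData` (`InitialDataSet.restrict` used
  `contMDiff_restrict` as a theorem; cascades to `CosmicCensorship`, `D.restrict U`) and
  `Literature.Geometry.Lorentzian.MassInequalities`. Intended pattern: thread the fact as an
  explicit parameter; do not universally quantify it inside statements. Both `contMDiff_restrict`
  facts are Mathlib-level bookkeeping (restriction of `C^n` sections to an `Opens`); a discharge
  item proving them removes the parameter everywhere.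

## References

* B. O'Neill, *Semi-Riemannian geometry with applications to relativity*, Academic Press 1983,
  Ch. 3 (Def. 3.1, Lemma 3.24 ff.), Ch. 5 (pp. 140–145: causal character, timecones,
  reverse Cauchy–Schwarz 5.30, time-orientability 5.32).
* S. W. Hawking, G. F. R. Ellis, *The large scale structure of space-time*, CUP 1973, §3.1
  (spacetime = connected Hausdorff time-oriented Lorentzian 4-manifold).
-/

open Manifold Bundle TopologicalSpace
open scoped ContDiff Topology

noncomputable section

universe u

namespace Literature.Geometry.Lorentzian

variable {E : Type*} [NormedAddCommGroup E] [NormedSpace ℝ E] {H : Type*} [TopologicalSpace H]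
  {I : ModelWithCorners ℝ E H} {n : ℕ∞ω} {M : Type*} [TopologicalSpace M] [ChartedSpace H M]
  [IsManifold I ∞ M]

/-! ### Restriction of a tangent-bundle metric to an open set -/

namespace PseudoRiemannianMetric

/-- The restriction of a `C^n` section of the bundle of bilinear forms on `TM` to an open subset
`U ⊆ M` is a `C^n` section of the bundle of bilinear forms on `TU` (the charts of `U` are the
restrictions of the charts of `M`). O'Neill 1983, Ch. 3, p. 57 (open submanifolds). [cite: ONeill1983, Ch. 3  p. 57 (open submanifolds] -/
def contMDiff_restrict : Prop :=
  ∀ (g : PseudoRiemannianMetric I n E (TangentSpace I : M → Type _)) (U : Opens M),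
    ContMDiff I (I.prod 𝓘(ℝ, E →L[ℝ] E →L[ℝ] ℝ)) n
      (fun x : U ↦ TotalSpace.mk' (F := E →L[ℝ] E →L[ℝ] ℝ)
        (E := fun y : U ↦ TangentSpace I y →L[ℝ] TangentSpace I y →L[ℝ] ℝ) x (g.val x.1))

/-- The **restriction** `g|_U` of a pseudo-Riemannian metric on the tangent bundle of `M` to an
open subset `U : Opens M` (an open submanifold, with `T_x U = T_x M = E` definitionally).
Smoothness of restricted sections, `contMDiff_restrict`, is the hypothesis `hres`.
O'Neill 1983, Ch. 3, p. 57. [cite: ONeill1983, Ch. 3  p. 57] -/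
def restrict (hres : contMDiff_restrict (I := I) (n := n) (M := M))
    (g : PseudoRiemannianMetric I n E (TangentSpace I : M → Type _)) (U : Opens M) :
    PseudoRiemannianMetric I n E (TangentSpace I : U → Type _) where
  val x := g.val x.1
  symm x := g.symm x.1
  nondegenerate x := g.nondegenerate x.1
  contMDiff := hres g U

/-- The restricted metric at `x : U` is the metric at `↑x`. [folklore] -/
@[simp]
lemma val_restrict (hres : contMDiff_restrict (I := I) (n := n) (M := M))
    (g : PseudoRiemannianMetric I n E (TangentSpace I : M → Type _)) (U : Opens M)
    (x : U) : (g.restrict hres U).val x = g.val x.1 := rfl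

end PseudoRiemannianMetric

/-! ### Lorentzian metrics -/

variable (I n M) in
/-- **gr.S13** (Lorentzian manifold; O'Neill 1983 Ch. 3, Hawking–Ellis §3.1). A `C^n`
**Lorentzian metric** on a manifold `M` modelled on `I`: a `C^n` pseudo-Riemannian metric `g` on
the tangent bundle `TM` of signature `(−,+,…,+)`, i.e. at every point `x` there is a vector `v`
with `g_x(v,v) < 0` (*timelike*), and `g_x` is positive definite on the `g_x`-orthogonal complement
of every timelike vector. Equivalently (`index_eq_one`) `g_x` has index `1` at every point.
O'Neill 1983, Ch. 3, Def. 3.1 and p. 55; Ch. 5, Lemma 5.26. [cite: ONeill1983, Ch. 3  Hawking–Ellis §3.1] -/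
structure LorentzianMetric extends PseudoRiemannianMetric I n E (TangentSpace I : M → Type _) where
  /-- At every point there is a timelike vector. -/
  exists_timelike (x : M) : ∃ v, val x v v < 0
  /-- The orthogonal complement of a timelike vector is spacelike (positive definite). -/
  pos_of_orthogonal (x : M) (v w : TangentSpace I x) (hv : val x v v < 0) (hvw : val x v w = 0)
    (hw : w ≠ 0) : 0 < val x w w

namespace LorentzianMetric

variable (g : LorentzianMetric I n M)

/-- A Lorentzian metric has index `1` (exactly one minus sign in Sylvester normal form) at every
point. O'Neill 1983, Ch. 3, p. 55; Ch. 5, Lemma 5.26. [cite: ONeill1983, Ch. 3  p. 55] -/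
def index_eq_one : Prop :=
  ∀ [FiniteDimensional ℝ E] (x : M),
    g.index x = 1

/-- The model space of a manifold carrying a Lorentzian metric has positive dimension (there is
a nonzero — timelike — tangent vector at any point `x`; Mathlib
`Module.finrank_pos_iff_exists_ne_zero`). O'Neill 1983, Ch. 3, p. 55. [folklore] -/
theorem finrank_pos (g : LorentzianMetric I n M) [FiniteDimensional ℝ E] (x : M) :
    0 < Module.finrank ℝ E := by
  obtain ⟨v, hv⟩ := g.exists_timelike x
  refine Module.finrank_pos_iff_exists_ne_zero.mpr ⟨(v : E), fun h ↦ ?_⟩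
  have h0 : g.val x v v = 0 := by rw [show v = 0 from h, map_zero]
  exact (lt_irrefl 0) (h0 ▸ hv)

/-! ### Causal character of tangent vectors -/

variable {x : M}

/-- A tangent vector `v` is **timelike** if `g(v,v) < 0`. O'Neill 1983, Ch. 3, p. 56. [cite: ONeill1983, Ch. 3  p. 56] -/
def IsTimelike (v : TangentSpace I x) : Prop := g.val x v v < 0

/-- A tangent vector `v` is **null** (lightlike) if `g(v,v) = 0` and `v ≠ 0`.
O'Neill 1983, Ch. 3, p. 56. [cite: ONeill1983, Ch. 3  p. 56] -/
def IsNull (v : TangentSpace I x) : Prop := g.val x v v = 0 ∧ v ≠ 0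

/-- A tangent vector `v` is **causal** (non-spacelike) if `g(v,v) ≤ 0` and `v ≠ 0`, i.e. it is
timelike or null. O'Neill 1983, Ch. 5, p. 140. [cite: ONeill1983, Ch. 5  p. 140] -/
def IsCausal (v : TangentSpace I x) : Prop := g.val x v v ≤ 0 ∧ v ≠ 0

/-- A tangent vector `v` is **spacelike** if `g(v,v) > 0` or `v = 0`. O'Neill 1983, Ch. 3,
p. 56. [cite: ONeill1983, Ch. 3  p. 56] -/
def IsSpacelike (v : TangentSpace I x) : Prop := 0 < g.val x v v ∨ v = 0

/-- Unfolding lemma for `IsTimelike`. O'Neill 1983, Ch. 3, p. 56. [cite: ONeill1983, Ch. 3  p. 56] -/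
lemma isTimelike_iff (v : TangentSpace I x) : g.IsTimelike v ↔ g.val x v v < 0 := Iff.rfl

/-- Unfolding lemma for `IsNull`. O'Neill 1983, Ch. 3, p. 56. [cite: ONeill1983, Ch. 3  p. 56] -/
lemma isNull_iff (v : TangentSpace I x) : g.IsNull v ↔ g.val x v v = 0 ∧ v ≠ 0 := Iff.rfl

/-- Unfolding lemma for `IsCausal`. O'Neill 1983, Ch. 5, p. 140. [cite: ONeill1983, Ch. 5  p. 140] -/
lemma isCausal_iff (v : TangentSpace I x) : g.IsCausal v ↔ g.val x v v ≤ 0 ∧ v ≠ 0 := Iff.rfl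

/-- Unfolding lemma for `IsSpacelike`. O'Neill 1983, Ch. 3, p. 56. [cite: ONeill1983, Ch. 3  p. 56] -/
lemma isSpacelike_iff (v : TangentSpace I x) : g.IsSpacelike v ↔ 0 < g.val x v v ∨ v = 0 :=
  Iff.rfl

/-- A timelike vector is nonzero. O'Neill 1983, Ch. 3, p. 56. [cite: ONeill1983, Ch. 3  p. 56] -/
lemma IsTimelike.ne_zero {v : TangentSpace I x} (hv : g.IsTimelike v) : v ≠ 0 := by
  rintro rfl
  simp [IsTimelike] at hv

/-- Timelike vectors are causal. O'Neill 1983, Ch. 5, p. 140. [cite: ONeill1983, Ch. 5  p. 140] -/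
lemma IsTimelike.isCausal {v : TangentSpace I x} (hv : g.IsTimelike v) : g.IsCausal v :=
  ⟨le_of_lt hv, hv.ne_zero⟩

/-- Null vectors are causal. O'Neill 1983, Ch. 5, p. 140. [cite: ONeill1983, Ch. 5  p. 140] -/
lemma IsNull.isCausal {v : TangentSpace I x} (hv : g.IsNull v) : g.IsCausal v :=
  ⟨le_of_eq hv.1, hv.2⟩

/-- A causal vector is timelike or null. O'Neill 1983, Ch. 5, p. 140. [cite: ONeill1983, Ch. 5  p. 140] -/
lemma isCausal_iff_isTimelike_or_isNull (v : TangentSpace I x) :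
    g.IsCausal v ↔ g.IsTimelike v ∨ g.IsNull v := by
  refine ⟨fun h ↦ ?_, fun h ↦ h.elim (fun h ↦ h.isCausal) (fun h ↦ h.isCausal)⟩
  rcases h.1.lt_or_eq with h' | h'
  · exact Or.inl h'
  · exact Or.inr ⟨h', h.2⟩

/-- The zero vector is spacelike (O'Neill's convention). O'Neill 1983, Ch. 3, p. 56. [cite: ONeill1983, Ch. 3  p. 56] -/
@[simp]
lemma isSpacelike_zero : g.IsSpacelike (0 : TangentSpace I x) := Or.inr rfl

/-- The zero vector is not causal. O'Neill 1983, Ch. 5, p. 140. [cite: ONeill1983, Ch. 5  p. 140] -/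
@[simp]
lemma not_isCausal_zero : ¬ g.IsCausal (0 : TangentSpace I x) := fun h ↦ h.2 rfl

/-- Every tangent vector is exactly one of spacelike / causal: `v` is spacelike iff it is not
causal (trichotomy timelike / null / spacelike for nonzero vectors). O'Neill 1983, Ch. 3, p. 56. [cite: ONeill1983, Ch. 3  p. 56] -/
lemma isSpacelike_iff_not_isCausal (v : TangentSpace I x) : g.IsSpacelike v ↔ ¬ g.IsCausal v := by
  by_cases hv : v = 0
  · subst hv; simp
  · simp [IsSpacelike, IsCausal, hv]

/-- Timelikeness is invariant under `v ↦ -v`. O'Neill 1983, Ch. 5, p. 140. [cite: ONeill1983, Ch. 5  p. 140] -/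
@[simp]
lemma isTimelike_neg_iff (v : TangentSpace I x) : g.IsTimelike (-v) ↔ g.IsTimelike v := by
  simp [IsTimelike]

/-- Causality is invariant under `v ↦ -v`. O'Neill 1983, Ch. 5, p. 140. [cite: ONeill1983, Ch. 5  p. 140] -/
@[simp]
lemma isCausal_neg_iff (v : TangentSpace I x) : g.IsCausal (-v) ↔ g.IsCausal v := by
  simp [IsCausal]

/-- A vector orthogonal to a timelike vector is spacelike. O'Neill 1983, Ch. 5, Lemma 5.26. [cite: ONeill1983, Ch. 5  Lemma 5.26] -/
lemma isSpacelike_of_orthogonal {v w : TangentSpace I x} (hv : g.IsTimelike v)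
    (hvw : g.val x v w = 0) : g.IsSpacelike w := by
  by_cases hw : w = 0
  · exact Or.inr hw
  · exact Or.inl (g.pos_of_orthogonal x v w hv hvw hw)

/-- A causal vector is never orthogonal to a timelike vector. O'Neill 1983, Ch. 5, Lemma 5.26
and Cor. 5.27. [cite: ONeill1983, Ch. 5  Lemma 5.26 and Cor. 5.27] -/
lemma val_ne_zero_of_isTimelike_of_isCausal {v w : TangentSpace I x} (hv : g.IsTimelike v)
    (hw : g.IsCausal w) : g.val x v w ≠ 0 := fun hvw ↦
  ((g.isSpacelike_iff_not_isCausal w).mp (g.isSpacelike_of_orthogonal hv hvw)) hw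

/-- **Reverse Cauchy–Schwarz inequality**: if `v` is timelike then
`g(v,w)² ≥ g(v,v) g(w,w)` for every `w` (for `w` timelike, `|g(v,w)| ≥ |v| |w|`); only the
inequality is stated (O'Neill's equality clause "iff `v, w` are collinear" is not recorded).
O'Neill 1983, Ch. 5, Prop. 5.30 (1). [cite: ONeill1983, Ch. 5 Prop. 5.30 (1)] -/
def mul_le_sq_of_isTimelike : Prop :=
  ∀ {v : TangentSpace I x} (_ : g.IsTimelike v) (w : TangentSpace I x),
    g.val x v v * g.val x w w ≤ g.val x v w ^ 2

/-- Timelike vectors in the same timecone (`g(v,w) < 0`) have timelike sum (timecones are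
convex cones). O'Neill 1983, Ch. 5, Lemma 5.29. [cite: ONeill1983, Ch. 5  Lemma 5.29] -/
theorem isTimelike_add_of_val_neg {v w : TangentSpace I x} (hv : g.IsTimelike v)
    (hw : g.IsTimelike w) (hvw : g.val x v w < 0) : g.IsTimelike (v + w) := by
  have hwv : g.val x w v < 0 := by rwa [g.symm]
  simp only [IsTimelike, map_add, FunLike.coe_add, Pi.add_apply] at *
  linarith

/-! ### Restriction to an open set -/

/-- The **restriction** `g|_U` of a Lorentzian metric to an open subset `U : Opens M` is a
Lorentzian metric on the open submanifold `U` (smoothness of restricted sections,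
`PseudoRiemannianMetric.contMDiff_restrict`, is the hypothesis `hres`). O'Neill 1983, Ch. 3,
p. 57. [cite: ONeill1983, Ch. 3  p. 57] -/
def restrict (hres : PseudoRiemannianMetric.contMDiff_restrict (I := I) (n := n) (M := M))
    (U : Opens M) : LorentzianMetric I n U where
  toPseudoRiemannianMetric := g.toPseudoRiemannianMetric.restrict hres U
  exists_timelike x := g.exists_timelike x.1
  pos_of_orthogonal x := g.pos_of_orthogonal x.1

/-- The restricted metric at `x : U` is the metric at `↑x`. [folklore] -/
@[simp]
lemma val_restrict (hres : PseudoRiemannianMetric.contMDiff_restrict (I := I) (n := n) (M := M))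
    (U : Opens M) (x : U) : (g.restrict hres U).val x = g.val x.1 := rfl

end LorentzianMetric

/-! ### Time orientations -/

/-- A **time orientation** of a Lorentzian metric `g` on `M`: a `C^n` vector field `T` on `M`
(a `C^n` section of the tangent bundle) which is timelike at every point. Its existence is
equivalent to time-orientability (a continuous choice of timecone), O'Neill 1983, Ch. 5,
Lemma 5.32; Hawking–Ellis 1973, §3.1 (the arrow of time is part of the data of a spacetime). [cite: ONeill1983, Ch. 5  Lemma 5.32] -/
structure TimeOrientation (g : LorentzianMetric I n M) where
  /-- The timelike vector field selecting the future timecone at every point. -/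
  vectorField (x : M) : TangentSpace I x
  /-- The vector field is timelike everywhere. -/
  isTimelike (x : M) : g.IsTimelike (vectorField x)
  /-- The vector field is a `C^n` section of the tangent bundle. -/
  contMDiff :
    ContMDiff I I.tangent n (fun x ↦ (TotalSpace.mk' E x (vectorField x) : TangentBundle I M))

namespace TimeOrientation

variable {g : LorentzianMetric I n M} (τ : TimeOrientation g) {x : M}

/-- A tangent vector `v` at `x` is **future-directed** (future-pointing causal) w.r.t. the time
orientation `τ` if it is causal and lies in the timecone of `τ x`, i.e. `g(τ x, v) < 0`.
O'Neill 1983, Ch. 5, p. 145; Hawking–Ellis 1973, §3.1. [cite: ONeill1983, Ch. 5  p. 145] -/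
def IsFutureDirected (v : TangentSpace I x) : Prop :=
  g.IsCausal v ∧ g.val x (τ.vectorField x) v < 0

/-- A tangent vector `v` at `x` is **past-directed** w.r.t. `τ` if it is causal and
`g(τ x, v) > 0`. O'Neill 1983, Ch. 5, p. 145. [cite: ONeill1983, Ch. 5  p. 145] -/
def IsPastDirected (v : TangentSpace I x) : Prop :=
  g.IsCausal v ∧ 0 < g.val x (τ.vectorField x) v

/-- Unfolding lemma for `IsFutureDirected`. [folklore] -/
lemma isFutureDirected_iff (v : TangentSpace I x) :
    τ.IsFutureDirected v ↔ g.IsCausal v ∧ g.val x (τ.vectorField x) v < 0 := Iff.rfl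

/-- Unfolding lemma for `IsPastDirected`. [folklore] -/
lemma isPastDirected_iff (v : TangentSpace I x) :
    τ.IsPastDirected v ↔ g.IsCausal v ∧ 0 < g.val x (τ.vectorField x) v := Iff.rfl

/-- The orienting vector field itself is future-directed. O'Neill 1983, Ch. 5, p. 145. [cite: ONeill1983, Ch. 5  p. 145] -/
lemma isFutureDirected_vectorField (x : M) : τ.IsFutureDirected (τ.vectorField x) :=
  ⟨(τ.isTimelike x).isCausal, τ.isTimelike x⟩

/-- Every causal vector is either future- or past-directed (a causal vector is never orthogonal
to a timelike one). O'Neill 1983, Ch. 5, Lemma 5.26 ff., p. 145. [cite: ONeill1983, Ch. 5  Lemma 5.26 ff.  p. 145] -/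
theorem isFutureDirected_or_isPastDirected_of_isCausal {v : TangentSpace I x}
    (hv : g.IsCausal v) : τ.IsFutureDirected v ∨ τ.IsPastDirected v := by
  rcases lt_trichotomy (g.val x (τ.vectorField x) v) 0 with h | h | h
  · exact Or.inl ⟨hv, h⟩
  · exact absurd h (g.val_ne_zero_of_isTimelike_of_isCausal (τ.isTimelike x) hv)
  · exact Or.inr ⟨hv, h⟩

/-- No vector is both future- and past-directed. O'Neill 1983, Ch. 5, p. 145. [cite: ONeill1983, Ch. 5  p. 145] -/
lemma not_isPastDirected_of_isFutureDirected {v : TangentSpace I x}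
    (hv : τ.IsFutureDirected v) : ¬ τ.IsPastDirected v :=
  fun h ↦ lt_asymm hv.2 h.2

/-- `v` is past-directed iff `-v` is future-directed. O'Neill 1983, Ch. 5, p. 145. [cite: ONeill1983, Ch. 5  p. 145] -/
@[simp]
lemma isFutureDirected_neg_iff (v : TangentSpace I x) :
    τ.IsFutureDirected (-v) ↔ τ.IsPastDirected v := by
  simp [IsFutureDirected, IsPastDirected]

/-- The **reversed** time orientation `-T` (swaps future and past). O'Neill 1983, Ch. 5,
p. 145. Smoothness by `ContMDiff.neg_section`. [cite: ONeill1983, Ch. 5  p. 145. Smoothness by  ContMDiff] -/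
def reverse : TimeOrientation g where
  vectorField x := -τ.vectorField x
  isTimelike x := (g.isTimelike_neg_iff _).mpr (τ.isTimelike x)
  contMDiff := τ.contMDiff.neg_section

/-- The vector field of the reversed time orientation. [folklore] -/
@[simp]
lemma vectorField_reverse (x : M) : τ.reverse.vectorField x = -τ.vectorField x := rfl

/-- Future-directed for the reversed orientation means past-directed. O'Neill 1983, Ch. 5,
p. 145. [cite: ONeill1983, Ch. 5  p. 145] -/
@[simp]
lemma isFutureDirected_reverse_iff (v : TangentSpace I x) :
    τ.reverse.IsFutureDirected v ↔ τ.IsPastDirected v := by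
  simp [IsFutureDirected, IsPastDirected]

/-- The restriction to an open subset `U ⊆ M` of a `C^n` vector field on `M` is a `C^n` section
of the tangent bundle of the open submanifold `U`. O'Neill 1983, Ch. 3, p. 57. [cite: ONeill1983, Ch. 3  p. 57] -/
def contMDiff_restrict : Prop :=
  ∀ (U : Opens M),
    ContMDiff I I.tangent n
      (fun x : U ↦ (TotalSpace.mk' E x (τ.vectorField x.1) : TangentBundle I U))

/-- The **restriction** of a time orientation to an open subset `U : Opens M`, a time
orientation of `g|_U` (smoothness of the restricted sections, `contMDiff_restrict` for `g` and
`τ`, are the hypotheses `hres`, `hτ`). O'Neill 1983, Ch. 3, p. 57 and Ch. 5, p. 145. [cite: ONeill1983, Ch. 3  p. 57 and Ch. 5  p. 145] -/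
def restrict (hres : PseudoRiemannianMetric.contMDiff_restrict (I := I) (n := n) (M := M))
    (hτ : τ.contMDiff_restrict) (U : Opens M) : TimeOrientation (g.restrict hres U) where
  vectorField x := τ.vectorField x.1
  isTimelike x := τ.isTimelike x.1
  contMDiff := hτ U

/-- The vector field of the restricted time orientation. [folklore] -/
@[simp]
lemma vectorField_restrict (hres : PseudoRiemannianMetric.contMDiff_restrict (I := I) (n := n) (M := M))
    (hτ : τ.contMDiff_restrict) (U : Opens M) (x : U) :
    (τ.restrict hres hτ U).vectorField x = τ.vectorField x.1 := rfl

end TimeOrientation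

/-! ### Bundled Lorentzian manifolds and spacetimes -/

/-- A (bundled) **Lorentzian manifold** of dimension `d` and metric regularity `C^n`: a
connected, Hausdorff, second countable `C^∞` manifold `carrier` modelled on
`EuclideanSpace ℝ (Fin d)` (model `𝓡 d`), together with a `C^n` Lorentzian metric.
O'Neill 1983, Ch. 3, Def. 3.1 ff.; Hawking–Ellis 1973, §3.1. Universe-polymorphic in the
carrier. [cite: ONeill1983, Ch. 3  Def. 3.1 ff] -/
structure LorentzianManifold (d : ℕ) (n : ℕ∞ω) : Type (u + 1) where
  /-- The underlying type of points (events). -/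
  carrier : Type u
  /-- The topology of the carrier. -/
  [topologicalSpace : TopologicalSpace carrier]
  /-- The `C^∞` atlas modelled on `ℝ^d`. -/
  [chartedSpace : ChartedSpace (EuclideanSpace ℝ (Fin d)) carrier]
  /-- The charts are `C^∞`-compatible. -/
  [isManifold : IsManifold (𝓡 d) ∞ carrier]
  /-- The carrier is Hausdorff. -/
  [t2Space : T2Space carrier]
  /-- The carrier is second countable (equivalently, for connected manifolds, paracompact). -/
  [secondCountableTopology : SecondCountableTopology carrier]
  /-- The carrier is connected. -/
  [connectedSpace : ConnectedSpace carrier]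
  /-- The Lorentzian metric. -/
  metric : LorentzianMetric (𝓡 d) n carrier

attribute [instance] LorentzianManifold.topologicalSpace LorentzianManifold.chartedSpace
  LorentzianManifold.isManifold LorentzianManifold.t2Space
  LorentzianManifold.secondCountableTopology LorentzianManifold.connectedSpace

/-- **gr.S13** (spacetime; Hawking–Ellis 1973 §3.1, O'Neill 1983 Ch. 5). A **spacetime** of
dimension `d`: a connected, Hausdorff, second countable `C^∞` Lorentzian `d`-manifold together
with a time orientation (a smooth timelike vector field). Hawking–Ellis take `d = 4`. [cite: HawkingEllis1973, §3.1  O'Neill 1983 Ch. 5] -/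
structure Spacetime (d : ℕ) : Type (u + 1) extends LorentzianManifold.{u} d ∞ where
  /-- The time orientation. -/
  timeOrientation : TimeOrientation metric

namespace LorentzianManifold

variable {d : ℕ}

/-- The open submanifold `U` of a Lorentzian manifold, for a connected open `U`, with the
restricted metric (smoothness of restricted sections, `PseudoRiemannianMetric.contMDiff_restrict`,
is the hypothesis `hres`). O'Neill 1983, Ch. 3, p. 57. [cite: ONeill1983, Ch. 3  p. 57] -/
def restrict (L : LorentzianManifold.{u} d n)
    (hres : PseudoRiemannianMetric.contMDiff_restrict (I := 𝓡 d) (n := n) (M := L.carrier))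
    (U : Opens L.carrier) (hU : IsConnected (U : Set L.carrier)) : LorentzianManifold.{u} d n :=
  letI : ConnectedSpace U := isConnected_iff_connectedSpace.mp hU
  { carrier := U
    metric := L.metric.restrict hres U }

end LorentzianManifold

namespace Spacetime

variable {d : ℕ}

/-- The open sub-spacetime `U` of a spacetime, for a connected open `U`, with the restricted
metric and time orientation (smoothness of restricted sections are the hypotheses `hres`, `hτ`).
Hawking–Ellis 1973, §3.1; O'Neill 1983, Ch. 3, p. 57. [cite: HawkingEllis1973, §3.1] -/
def restrict (S : Spacetime.{u} d)
    (hres : PseudoRiemannianMetric.contMDiff_restrict (I := 𝓡 d) (n := ∞) (M := S.carrier))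
    (hτ : S.timeOrientation.contMDiff_restrict)
    (U : Opens S.carrier) (hU : IsConnected (U : Set S.carrier)) : Spacetime.{u} d :=
  letI : ConnectedSpace U := isConnected_iff_connectedSpace.mp hU
  { carrier := U
    metric := S.metric.restrict hres U
    timeOrientation := S.timeOrientation.restrict hres hτ U }

/-- The carrier of the restricted spacetime is `U`. [folklore] -/
lemma carrier_restrict (S : Spacetime.{u} d)
    (hres : PseudoRiemannianMetric.contMDiff_restrict (I := 𝓡 d) (n := ∞) (M := S.carrier))
    (hτ : S.timeOrientation.contMDiff_restrict)
    (U : Opens S.carrier) (hU : IsConnected (U : Set S.carrier)) :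
    (S.restrict hres hτ U hU).carrier = U := rfl

end Spacetime

end Literature.Geometry.Lorentzian

end
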